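import Mathlib
import HarnessLib
import Summits.NavierStokesRegularity.NavierStokesRegularity.Theorems.UnthreadedRigidityDoorUnthreadedRigidityProfileHornMoments

/-!
# Route `UnthreadedRigidityDoor`, item `UnthreadedRigidity` (W2, stmt-NavierStokesRegularity-27585) — LINE g10-2 «PROFILE HORN»:
# THEOREM PHR, file 3/3 — the case `r₀ = 0` (limits at the apex) and `profileHornRigidity_holds : ProfileHornRigidity` BY NAME

Prover file (W2 Lean hand ns-crc-p1 g7, keyed by DIRECTOR-NS dss_128 / KEY-NS #184; `--supports stmt-NavierStokesRegularity-27585 --as helper`)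
for LINE g10-2 «PROFILE HORN» of planner ns-idea-6 g10 on the wall item `UnthreadedRigidity` (route `UnthreadedRigidityDoor`, W2;
idea-crit-4 g6 PASS 2026-08-29T01:30:55Z; sketch `pub/ideators/ns-idea-6/lines/UnthreadedRigidityDoor/ProfileHorn_sketch.lean` sha16
916bdf9b3eac7d48; objects and statements BY NAME in `Theorems/UnthreadedRigidityDoorUnthreadedRigidityProfileHornDefs.lean`).

Part E: as `r → 0⁺`, `W̃(r) → 144h(0)² + (288/7)h(0)²` (the inner moments are `O(r⁷)`, `O(r¹¹)`; `J₂ → (12/7)G₂(0) = −(180/7)h(0)²`),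
and, once `h(0) = 0`, `W̃(r)/r² → (10240/21)∫_(0,∞)ρh′(ρ²)²` (slope of `h` at the apex, `|a₂| ≤ Kρ²`); hence a sequence `uₙ → 0⁺` with
`W̃(uₙ) = 0` forces `h(0) = 0` and `∫_(0,∞)ρh′(ρ²)² = 0`.
Part F: THEOREM PHR.  `S = {ρ > 0 : K(ρ) ≠ 0}`.  If `S = ∅` the profile is flat and the decay clause kills it.  Else `r₀ = inf S`,
`K = 0` on `(0,r₀)`, `W̃(uₙ) = 0` along `uₙ ∈ S`, `uₙ → r₀`: at `r₀ > 0` continuity gives `W̃(r₀) = 0`, i.e. `h(0) = 0` and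
`∫_(r₀,∞)ρh′(ρ²)² = 0`, so `h′(ρ²) = 0` on `(0,r₀]` and on `(r₀,∞)`; at `r₀ = 0` Part E gives the same.  Either way `H ≡ h(0) = 0`.

HONEST LABEL: one-dimensional real analysis about the radial profile of SPECIAL (separable `l = 2`) slice data; it is a piece of a LINE on
the wall item, not the item: `UnthreadedRigidity` (27585), W2 and NS regularity remain OPEN; nothing here is a statement about the
Navier–Stokes equations.  0 kit.
-/

-- the summit and its single sub-problem share the name (CONVENTIONS §1), as in every Theorems file
set_option linter.dupNamespace false

namespace Summit.NavierStokesRegularity.NavierStokesRegularity.Theorems.UnthreadedRigidity.ProfileHorn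

open scoped Topology
open Filter Set MeasureTheory

/-! ## Part E — the case `r₀ = 0`: limits of the bracket as `r → 0⁺` -/

section Limits

open scoped ContDiff

variable {h H : ℝ → ℝ} {C : ℝ}

/-- squeeze for primitives: `|f| ≤ M ρ^(m+1)` on `[0,1]` ⇒ `r^(−m) ∫₀ʳ f → 0` as `r → 0⁺`. -/
theorem tendsto_inv_pow_mul_integral {f : ℝ → ℝ} {M : ℝ} {m : ℕ}
    (hM : ∀ ρ ∈ Icc (0:ℝ) 1, |f ρ| ≤ M * ρ ^ (m + 1)) :
    Tendsto (fun r => (r ^ m)⁻¹ * ∫ ρ in (0:ℝ)..r, f ρ) (𝓝[>] 0) (𝓝 0) := by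
  have hM0 : 0 ≤ M := le_trans (abs_nonneg _) (by simpa using hM 1 ⟨zero_le_one, le_rfl⟩)
  have hb : Tendsto (fun r : ℝ => M * r ^ 2) (𝓝[>] 0) (𝓝 0) := by
    have : Tendsto (fun r : ℝ => M * r ^ 2) (𝓝 0) (𝓝 (M * 0 ^ 2)) :=
      (continuous_const.mul (continuous_pow 2)).tendsto 0
    simpa using this.mono_left nhdsWithin_le_nhds
  refine squeeze_zero_norm' ?_ hb
  filter_upwards [Ioo_mem_nhdsGT (zero_lt_one : (0:ℝ) < 1)] with r hr
  have hr0 : 0 < r := hr.1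
  have hint : ‖∫ ρ in (0:ℝ)..r, f ρ‖ ≤ M * r ^ (m + 1) * |r - 0| := by
    refine intervalIntegral.norm_integral_le_of_norm_le_const fun ρ hρ => ?_
    rw [uIoc_of_le hr0.le] at hρ
    rw [Real.norm_eq_abs]
    calc |f ρ| ≤ M * ρ ^ (m + 1) := hM ρ ⟨hρ.1.le, hρ.2.trans hr.2.le⟩
      _ ≤ M * r ^ (m + 1) := mul_le_mul_of_nonneg_left (pow_le_pow_left₀ hρ.1.le hρ.2 _) hM0
  rw [sub_zero, abs_of_pos hr0, Real.norm_eq_abs] at hint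
  rw [Real.norm_eq_abs, abs_mul, abs_inv, abs_of_pos (pow_pos hr0 m)]
  calc (r ^ m)⁻¹ * |∫ ρ in (0:ℝ)..r, f ρ| ≤ (r ^ m)⁻¹ * (M * r ^ (m + 1) * r) :=
        mul_le_mul_of_nonneg_left hint (by positivity)
    _ = M * r ^ 2 := by field_simp; ring

/-- a continuous function is bounded on `[0,1]`. -/
theorem exists_bound_Icc {g : ℝ → ℝ} (hg : Continuous g) : ∃ B, ∀ s ∈ Icc (0:ℝ) 1, |g s| ≤ B := by
  obtain ⟨B, hB⟩ := isCompact_Icc.exists_bound_of_continuousOn hg.continuousOn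
  exact ⟨B, fun s hs => by simpa [Real.norm_eq_abs] using hB s hs⟩

/-- mean value bound: `h(0) = 0` ⇒ `|h(s)| ≤ M s` on `[0,1]`. -/
theorem abs_le_mul_of_zero (hh : ContDiff ℝ ∞ h) (h0 : h 0 = 0) : ∃ M, ∀ s ∈ Icc (0:ℝ) 1, |h s| ≤ M * s := by
  obtain ⟨M, hM⟩ := exists_bound_Icc (smooth_deriv_of_smooth hh).continuous
  refine ⟨M, fun s hs => ?_⟩
  have hd := differentiable_of_smooth hh
  have key := norm_image_sub_le_of_norm_deriv_le_segment' (f := h) (f' := deriv h) (a := 0) (b := 1)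
    (fun x _ => (hd x).hasDerivAt.hasDerivWithinAt)
    (fun x hx => by rw [Real.norm_eq_abs]; exact hM x ⟨hx.1, hx.2.le⟩) s hs
  simpa [h0, Real.norm_eq_abs] using key

/-- slope at the apex: `Φ(0) = 0`, `Φ′(0) = Φ'` ⇒ `Φ(r²)/r² → Φ'` as `r → 0⁺`. -/
theorem tendsto_inv_sq_mul_comp_sq {Φ : ℝ → ℝ} {Φ' : ℝ} (hΦ : HasDerivAt Φ Φ' 0) (h0 : Φ 0 = 0) :
    Tendsto (fun r : ℝ => (r ^ 2)⁻¹ * Φ (r ^ 2)) (𝓝[>] 0) (𝓝 Φ') := by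
  have hsq : Tendsto (fun r : ℝ => r ^ 2) (𝓝[>] 0) (𝓝[>] 0) := by
    refine tendsto_nhdsWithin_iff.mpr ⟨?_, ?_⟩
    · simpa using ((continuous_pow 2).tendsto (0:ℝ)).mono_left nhdsWithin_le_nhds
    · filter_upwards [self_mem_nhdsWithin] with r hr using pow_pos (mem_Ioi.mp hr) 2
  have := hΦ.tendsto_slope_zero_right.comp hsq
  refine this.congr fun r => ?_
  simp [Function.comp, h0]

/-- right-continuity of the outer enstrophy integral at `0`: `∫_(r,∞) ρ h′(ρ²)² → ∫_(0,∞) ρ h′(ρ²)²` as `r → 0⁺`. -/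
theorem tendsto_P_nhdsGT (hh : ContDiff ℝ ∞ h) (hH : ∀ r, 0 ≤ r → H r = h (r ^ 2))
    (hC : ∀ r, 1 ≤ r → r ^ 5 * |H r| ≤ C ∧ r ^ 6 * |deriv H r| ≤ C ∧ r ^ 7 * |deriv (deriv H) r| ≤ C) : Tendsto (fun r => (∫ ρ in Ioi r, ρ * deriv h (ρ ^ 2) ^ 2)) (𝓝[>] 0) (𝓝 (∫ ρ in Ioi 0, ρ * deriv h (ρ ^ 2) ^ 2)) := by
  have hc1 := (smooth_deriv_of_smooth hh).continuous
  have hP0 := integrableOn_P_model (a := 0) hh hH hC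
  have hprim : Continuous fun r => ∫ ρ in (0:ℝ)..r, ρ * deriv h (ρ ^ 2) ^ 2 :=
    intervalIntegral.continuous_primitive (fun a b => (by fun_prop : Continuous fun ρ => ρ * deriv h (ρ ^ 2) ^ 2).intervalIntegrable a b) 0
  have h1 : Tendsto (fun r => (∫ ρ in Ioi 0, ρ * deriv h (ρ ^ 2) ^ 2) - ∫ ρ in (0:ℝ)..r, ρ * deriv h (ρ ^ 2) ^ 2) (𝓝[>] 0)
      (𝓝 ((∫ ρ in Ioi 0, ρ * deriv h (ρ ^ 2) ^ 2) - ∫ ρ in (0:ℝ)..0, ρ * deriv h (ρ ^ 2) ^ 2)) :=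
    ((continuous_const.sub hprim).tendsto 0).mono_left nhdsWithin_le_nhds
  rw [intervalIntegral.integral_same, sub_zero] at h1
  refine h1.congr' ?_
  filter_upwards [self_mem_nhdsWithin] with r hr
  rw [← intervalIntegral.integral_Ioi_sub_Ioi hP0 (le_of_lt hr)]
  ring

/-- FIRST ORDER: `W̃(r) → 144 h(0)² + (288/7) h(0)²` as `r → 0⁺`. -/
theorem tendsto_hornBracket_nhdsGT (hh : ContDiff ℝ ∞ h) (hH : ∀ r, 0 ≤ r → H r = h (r ^ 2))
    (hC : ∀ r, 1 ≤ r → r ^ 5 * |H r| ≤ C ∧ r ^ 6 * |deriv H r| ≤ C ∧ r ^ 7 * |deriv (deriv H) r| ≤ C) :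
    Tendsto (hornBracket H) (𝓝[>] 0) (𝓝 (144 * h 0 ^ 2 + 288 / 7 * h 0 ^ 2)) := by
  have hc0 := hh.continuous
  have hc1 := (smooth_deriv_of_smooth hh).continuous
  have hc2 := continuous_deriv_deriv_of_smooth hh
  obtain ⟨B2, hB2⟩ := exists_bound_Icc (g := fun ρ => 24 / 7 * (4 * ρ ^ 2 * deriv h (ρ ^ 2) ^ 2 + 42 * h (ρ ^ 2) * deriv h (ρ ^ 2) + 12 * ρ ^ 2 * h (ρ ^ 2) * deriv (deriv h) (ρ ^ 2) - 8 * ρ ^ 4 * deriv h (ρ ^ 2) * deriv (deriv h) (ρ ^ 2))) (by fun_prop)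
  obtain ⟨B4, hB4⟩ := exists_bound_Icc (g := fun ρ => 8 * (52 * deriv h (ρ ^ 2) ^ 2 - 12 * h (ρ ^ 2) * deriv (deriv h) (ρ ^ 2) + 8 * ρ ^ 2 * deriv h (ρ ^ 2) * deriv (deriv h) (ρ ^ 2))) (by fun_prop)
  have T2 : Tendsto (fun r => (r ^ 5)⁻¹ * (∫ ρ in (0:ℝ)..r, ρ ^ 6 * (24 / 7 * (4 * ρ ^ 2 * deriv h (ρ ^ 2) ^ 2 + 42 * h (ρ ^ 2) * deriv h (ρ ^ 2) + 12 * ρ ^ 2 * h (ρ ^ 2) * deriv (deriv h) (ρ ^ 2) - 8 * ρ ^ 4 * deriv h (ρ ^ 2) * deriv (deriv h) (ρ ^ 2))))) (𝓝[>] 0) (𝓝 0) := by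
    refine tendsto_inv_pow_mul_integral (m := 5) (M := B2) fun ρ hρ => ?_
    rw [abs_mul, abs_of_nonneg (pow_nonneg hρ.1 6)]
    calc ρ ^ 6 * |24 / 7 * (4 * ρ ^ 2 * deriv h (ρ ^ 2) ^ 2 + 42 * h (ρ ^ 2) * deriv h (ρ ^ 2) + 12 * ρ ^ 2 * h (ρ ^ 2) * deriv (deriv h) (ρ ^ 2) - 8 * ρ ^ 4 * deriv h (ρ ^ 2) * deriv (deriv h) (ρ ^ 2))| ≤ ρ ^ 6 * B2 := mul_le_mul_of_nonneg_left (hB2 ρ hρ) (pow_nonneg hρ.1 6)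
      _ = B2 * ρ ^ (5 + 1) := by ring
  have T4 : Tendsto (fun r => (r ^ 9)⁻¹ * (∫ ρ in (0:ℝ)..r, ρ ^ 10 * (8 * (52 * deriv h (ρ ^ 2) ^ 2 - 12 * h (ρ ^ 2) * deriv (deriv h) (ρ ^ 2) + 8 * ρ ^ 2 * deriv h (ρ ^ 2) * deriv (deriv h) (ρ ^ 2))))) (𝓝[>] 0) (𝓝 0) := by
    refine tendsto_inv_pow_mul_integral (m := 9) (M := B4) fun ρ hρ => ?_
    rw [abs_mul, abs_of_nonneg (pow_nonneg hρ.1 10)]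
    calc ρ ^ 10 * |8 * (52 * deriv h (ρ ^ 2) ^ 2 - 12 * h (ρ ^ 2) * deriv (deriv h) (ρ ^ 2) + 8 * ρ ^ 2 * deriv h (ρ ^ 2) * deriv (deriv h) (ρ ^ 2))| ≤ ρ ^ 10 * B4 := mul_le_mul_of_nonneg_left (hB4 ρ hρ) (pow_nonneg hρ.1 10)
      _ = B4 * ρ ^ (9 + 1) := by ring
  have Tα : Tendsto (fun r => 16 * (2 * r ^ 2 * deriv h (r ^ 2) + 3 * h (r ^ 2)) ^ 2) (𝓝[>] 0) (𝓝 (16 * (2 * (0:ℝ) ^ 2 * deriv h ((0:ℝ) ^ 2) + 3 * h ((0:ℝ) ^ 2)) ^ 2)) :=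
    ((by fun_prop : Continuous fun r => 16 * (2 * r ^ 2 * deriv h (r ^ 2) + 3 * h (r ^ 2)) ^ 2).tendsto 0).mono_left nhdsWithin_le_nhds
  have eα : 16 * (2 * (0:ℝ) ^ 2 * deriv h ((0:ℝ) ^ 2) + 3 * h ((0:ℝ) ^ 2)) ^ 2 = 144 * h 0 ^ 2 := by
    norm_num
    ring
  rw [eα] at Tα
  have TG : Tendsto (fun r => 96 / 35 * (4 * r ^ 4 * deriv h (r ^ 2) ^ 2 - 12 * r ^ 2 * h (r ^ 2) * deriv h (r ^ 2) - 15 * h (r ^ 2) ^ 2)) (𝓝[>] 0) (𝓝 (96 / 35 * (4 * (0:ℝ) ^ 4 * deriv h ((0:ℝ) ^ 2) ^ 2 - 12 * (0:ℝ) ^ 2 * h ((0:ℝ) ^ 2) * deriv h ((0:ℝ) ^ 2) - 15 * h ((0:ℝ) ^ 2) ^ 2))) :=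
    ((by fun_prop : Continuous fun r => 96 / 35 * (4 * r ^ 4 * deriv h (r ^ 2) ^ 2 - 12 * r ^ 2 * h (r ^ 2) * deriv h (r ^ 2) - 15 * h (r ^ 2) ^ 2)).tendsto 0).mono_left nhdsWithin_le_nhds
  have eG : 96 / 35 * (4 * (0:ℝ) ^ 4 * deriv h ((0:ℝ) ^ 2) ^ 2 - 12 * (0:ℝ) ^ 2 * h ((0:ℝ) ^ 2) * deriv h ((0:ℝ) ^ 2) - 15 * h ((0:ℝ) ^ 2) ^ 2) = -(288 / 7) * h 0 ^ 2 := by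
    norm_num
    ring
  rw [eG] at TG
  have TF : Tendsto (fun r => 512 / 63 * r ^ 2 * (2 * r ^ 2 * deriv h (r ^ 2) ^ 2 - 6 * h (r ^ 2) * deriv h (r ^ 2))) (𝓝[>] 0) (𝓝 (512 / 63 * (0:ℝ) ^ 2 * (2 * (0:ℝ) ^ 2 * deriv h ((0:ℝ) ^ 2) ^ 2 - 6 * h ((0:ℝ) ^ 2) * deriv h ((0:ℝ) ^ 2)))) :=
    ((by fun_prop : Continuous fun r => 512 / 63 * r ^ 2 * (2 * r ^ 2 * deriv h (r ^ 2) ^ 2 - 6 * h (r ^ 2) * deriv h (r ^ 2))).tendsto 0).mono_left nhdsWithin_le_nhds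
  have eF : 512 / 63 * (0:ℝ) ^ 2 * (2 * (0:ℝ) ^ 2 * deriv h ((0:ℝ) ^ 2) ^ 2 - 6 * h ((0:ℝ) ^ 2) * deriv h ((0:ℝ) ^ 2)) = 0 := by norm_num
  rw [eF] at TF
  have Tr2 : Tendsto (fun r : ℝ => r ^ 2) (𝓝[>] 0) (𝓝 0) := by
    simpa using ((continuous_pow 2).tendsto (0:ℝ)).mono_left nhdsWithin_le_nhds
  have TP := tendsto_P_nhdsGT hh hH hC
  have T := ((((Tα.add (T2.const_mul (12 / 5))).sub TG).sub ((Tr2.const_mul (80 / 63)).mul T4)).sub TF).add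
    ((Tr2.const_mul (10240 / 21)).mul TP)
  have key : Tendsto (fun r => 16 * (2 * r ^ 2 * deriv h (r ^ 2) + 3 * h (r ^ 2)) ^ 2
      + 12 / 5 * (r ^ 5)⁻¹ * (∫ ρ in (0:ℝ)..r, ρ ^ 6 * (24 / 7 * (4 * ρ ^ 2 * deriv h (ρ ^ 2) ^ 2 + 42 * h (ρ ^ 2) * deriv h (ρ ^ 2) + 12 * ρ ^ 2 * h (ρ ^ 2) * deriv (deriv h) (ρ ^ 2) - 8 * ρ ^ 4 * deriv h (ρ ^ 2) * deriv (deriv h) (ρ ^ 2))))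
      - 96 / 35 * (4 * r ^ 4 * deriv h (r ^ 2) ^ 2 - 12 * r ^ 2 * h (r ^ 2) * deriv h (r ^ 2) - 15 * h (r ^ 2) ^ 2)
      - 80 / 63 * r ^ 2 * (r ^ 9)⁻¹ * (∫ ρ in (0:ℝ)..r, ρ ^ 10 * (8 * (52 * deriv h (ρ ^ 2) ^ 2 - 12 * h (ρ ^ 2) * deriv (deriv h) (ρ ^ 2) + 8 * ρ ^ 2 * deriv h (ρ ^ 2) * deriv (deriv h) (ρ ^ 2))))
      - 512 / 63 * r ^ 2 * (2 * r ^ 2 * deriv h (r ^ 2) ^ 2 - 6 * h (r ^ 2) * deriv h (r ^ 2))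
      + 10240 / 21 * r ^ 2 * (∫ ρ in Ioi r, ρ * deriv h (ρ ^ 2) ^ 2)) (𝓝[>] 0)
      (𝓝 (144 * h 0 ^ 2 + 12 / 5 * 0 - -(288 / 7) * h 0 ^ 2 - 80 / 63 * 0 * 0 - 0 + 10240 / 21 * 0 * (∫ ρ in Ioi 0, ρ * deriv h (ρ ^ 2) ^ 2))) :=
    T.congr fun r => by ring
  have eV : 144 * h 0 ^ 2 + 12 / 5 * 0 - -(288 / 7) * h 0 ^ 2 - 80 / 63 * 0 * 0 - 0 + 10240 / 21 * 0 * (∫ ρ in Ioi 0, ρ * deriv h (ρ ^ 2) ^ 2)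
      = 144 * h 0 ^ 2 + 288 / 7 * h 0 ^ 2 := by ring
  rw [eV] at key
  refine key.congr' ?_
  filter_upwards [self_mem_nhdsWithin] with r hr
  exact (hornBracket_eq hh hH hC hr).symm

/-- SECOND ORDER (when `h(0) = 0`): `W̃(r)/r² → (10240/21) ∫_(0,∞) ρ h′(ρ²)²` as `r → 0⁺`. -/
theorem tendsto_hornBracket_div_sq_nhdsGT (hh : ContDiff ℝ ∞ h) (hH : ∀ r, 0 ≤ r → H r = h (r ^ 2))
    (hC : ∀ r, 1 ≤ r → r ^ 5 * |H r| ≤ C ∧ r ^ 6 * |deriv H r| ≤ C ∧ r ^ 7 * |deriv (deriv H) r| ≤ C) (h0 : h 0 = 0) :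
    Tendsto (fun r => hornBracket H r * (r ^ 2)⁻¹) (𝓝[>] 0) (𝓝 (10240 / 21 * (∫ ρ in Ioi 0, ρ * deriv h (ρ ^ 2) ^ 2))) := by
  have hc0 := hh.continuous
  have hc1 := (smooth_deriv_of_smooth hh).continuous
  have hc2 := continuous_deriv_deriv_of_smooth hh
  have hd := differentiable_of_smooth hh
  -- the slope of `h` at the apex
  have Th : Tendsto (fun r : ℝ => (r ^ 2)⁻¹ * h (r ^ 2)) (𝓝[>] 0) (𝓝 (deriv h 0)) :=
    tendsto_inv_sq_mul_comp_sq (hd 0).hasDerivAt h0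
  have Thc : Tendsto (fun r : ℝ => h (r ^ 2)) (𝓝[>] 0) (𝓝 0) := by
    have := ((continuous_comp_sq hc0).tendsto (0:ℝ)).mono_left (nhdsWithin_le_nhds (s := Ioi 0))
    simpa [h0] using this
  have Td1 : Tendsto (fun r : ℝ => deriv h (r ^ 2)) (𝓝[>] 0) (𝓝 (deriv h 0)) := by
    have := ((continuous_comp_sq hc1).tendsto (0:ℝ)).mono_left (nhdsWithin_le_nhds (s := Ioi 0))
    simpa using this
  have Tr2 : Tendsto (fun r : ℝ => r ^ 2) (𝓝[>] 0) (𝓝 0) := by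
    simpa using ((continuous_pow 2).tendsto (0:ℝ)).mono_left nhdsWithin_le_nhds
  -- bound `|a₂(ρ)| ≤ K ρ²` on `[0,1]` from `h(0) = 0`
  obtain ⟨M₁, hM₁⟩ := abs_le_mul_of_zero hh h0
  obtain ⟨BE, hBE⟩ := exists_bound_Icc (g := fun ρ => 4 * deriv h (ρ ^ 2) ^ 2 + 12 * h (ρ ^ 2) * deriv (deriv h) (ρ ^ 2)
    - 8 * ρ ^ 2 * deriv h (ρ ^ 2) * deriv (deriv h) (ρ ^ 2)) (by fun_prop)
  obtain ⟨B1, hB1⟩ := exists_bound_Icc (g := fun ρ => deriv h (ρ ^ 2)) (by fun_prop)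
  obtain ⟨B4, hB4⟩ := exists_bound_Icc (g := fun ρ => 8 * (52 * deriv h (ρ ^ 2) ^ 2 - 12 * h (ρ ^ 2) * deriv (deriv h) (ρ ^ 2) + 8 * ρ ^ 2 * deriv h (ρ ^ 2) * deriv (deriv h) (ρ ^ 2))) (by fun_prop)
  have hB1nn : 0 ≤ B1 := le_trans (abs_nonneg _) (hB1 0 ⟨le_rfl, zero_le_one⟩)
  have hA2 : ∀ ρ ∈ Icc (0:ℝ) 1, |24 / 7 * (4 * ρ ^ 2 * deriv h (ρ ^ 2) ^ 2 + 42 * h (ρ ^ 2) * deriv h (ρ ^ 2) + 12 * ρ ^ 2 * h (ρ ^ 2) * deriv (deriv h) (ρ ^ 2) - 8 * ρ ^ 4 * deriv h (ρ ^ 2) * deriv (deriv h) (ρ ^ 2))| ≤ 24 / 7 * ((BE + 42 * M₁ * B1) * ρ ^ 2) := by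
    intro ρ hρ
    have hρ2 : ρ ^ 2 ∈ Icc (0:ℝ) 1 := ⟨sq_nonneg _, by nlinarith [hρ.1, hρ.2]⟩
    have e : 24 / 7 * (4 * ρ ^ 2 * deriv h (ρ ^ 2) ^ 2 + 42 * h (ρ ^ 2) * deriv h (ρ ^ 2) + 12 * ρ ^ 2 * h (ρ ^ 2) * deriv (deriv h) (ρ ^ 2) - 8 * ρ ^ 4 * deriv h (ρ ^ 2) * deriv (deriv h) (ρ ^ 2)) = 24 / 7 * (ρ ^ 2 * (4 * deriv h (ρ ^ 2) ^ 2 + 12 * h (ρ ^ 2) * deriv (deriv h) (ρ ^ 2)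
        - 8 * ρ ^ 2 * deriv h (ρ ^ 2) * deriv (deriv h) (ρ ^ 2)) + 42 * (h (ρ ^ 2) * deriv h (ρ ^ 2))) := by ring
    rw [e, abs_mul, abs_of_pos (by norm_num : (0:ℝ) < 24 / 7)]
    refine mul_le_mul_of_nonneg_left ?_ (by norm_num)
    have h1 : |ρ ^ 2 * (4 * deriv h (ρ ^ 2) ^ 2 + 12 * h (ρ ^ 2) * deriv (deriv h) (ρ ^ 2) - 8 * ρ ^ 2 * deriv h (ρ ^ 2) * deriv (deriv h) (ρ ^ 2))|
        ≤ ρ ^ 2 * BE := by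
      rw [abs_mul, abs_of_nonneg (sq_nonneg ρ)]
      exact mul_le_mul_of_nonneg_left (hBE ρ hρ) (sq_nonneg ρ)
    have h2 : |42 * (h (ρ ^ 2) * deriv h (ρ ^ 2))| ≤ 42 * (M₁ * ρ ^ 2 * B1) := by
      rw [abs_mul, abs_of_pos (by norm_num : (0:ℝ) < 42), abs_mul]
      refine mul_le_mul_of_nonneg_left ?_ (by norm_num)
      exact mul_le_mul (hM₁ _ hρ2) (hB1 ρ hρ) (abs_nonneg _) (le_trans (abs_nonneg _) (hM₁ _ hρ2))
    calc _ ≤ |ρ ^ 2 * (4 * deriv h (ρ ^ 2) ^ 2 + 12 * h (ρ ^ 2) * deriv (deriv h) (ρ ^ 2) - 8 * ρ ^ 2 * deriv h (ρ ^ 2) * deriv (deriv h) (ρ ^ 2))|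
          + |42 * (h (ρ ^ 2) * deriv h (ρ ^ 2))| := abs_add_le _ _
      _ ≤ ρ ^ 2 * BE + 42 * (M₁ * ρ ^ 2 * B1) := add_le_add h1 h2
      _ = (BE + 42 * M₁ * B1) * ρ ^ 2 := by ring
  have T2 : Tendsto (fun r => (r ^ 7)⁻¹ * (∫ ρ in (0:ℝ)..r, ρ ^ 6 * (24 / 7 * (4 * ρ ^ 2 * deriv h (ρ ^ 2) ^ 2 + 42 * h (ρ ^ 2) * deriv h (ρ ^ 2) + 12 * ρ ^ 2 * h (ρ ^ 2) * deriv (deriv h) (ρ ^ 2) - 8 * ρ ^ 4 * deriv h (ρ ^ 2) * deriv (deriv h) (ρ ^ 2))))) (𝓝[>] 0) (𝓝 0) := by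
    refine tendsto_inv_pow_mul_integral (m := 7) (M := 24 / 7 * (BE + 42 * M₁ * B1)) fun ρ hρ => ?_
    rw [abs_mul, abs_of_nonneg (pow_nonneg hρ.1 6)]
    calc ρ ^ 6 * |24 / 7 * (4 * ρ ^ 2 * deriv h (ρ ^ 2) ^ 2 + 42 * h (ρ ^ 2) * deriv h (ρ ^ 2) + 12 * ρ ^ 2 * h (ρ ^ 2) * deriv (deriv h) (ρ ^ 2) - 8 * ρ ^ 4 * deriv h (ρ ^ 2) * deriv (deriv h) (ρ ^ 2))| ≤ ρ ^ 6 * (24 / 7 * ((BE + 42 * M₁ * B1) * ρ ^ 2)) :=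
          mul_le_mul_of_nonneg_left (hA2 ρ hρ) (pow_nonneg hρ.1 6)
      _ = 24 / 7 * (BE + 42 * M₁ * B1) * ρ ^ (7 + 1) := by ring
  have T4 : Tendsto (fun r => (r ^ 9)⁻¹ * (∫ ρ in (0:ℝ)..r, ρ ^ 10 * (8 * (52 * deriv h (ρ ^ 2) ^ 2 - 12 * h (ρ ^ 2) * deriv (deriv h) (ρ ^ 2) + 8 * ρ ^ 2 * deriv h (ρ ^ 2) * deriv (deriv h) (ρ ^ 2))))) (𝓝[>] 0) (𝓝 0) := by
    refine tendsto_inv_pow_mul_integral (m := 9) (M := B4) fun ρ hρ => ?_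
    rw [abs_mul, abs_of_nonneg (pow_nonneg hρ.1 10)]
    calc ρ ^ 10 * |8 * (52 * deriv h (ρ ^ 2) ^ 2 - 12 * h (ρ ^ 2) * deriv (deriv h) (ρ ^ 2) + 8 * ρ ^ 2 * deriv h (ρ ^ 2) * deriv (deriv h) (ρ ^ 2))| ≤ ρ ^ 10 * B4 := mul_le_mul_of_nonneg_left (hB4 ρ hρ) (pow_nonneg hρ.1 10)
      _ = B4 * ρ ^ (9 + 1) := by ring
  have TF : Tendsto (fun r => 512 / 63 * (2 * r ^ 2 * deriv h (r ^ 2) ^ 2 - 6 * h (r ^ 2) * deriv h (r ^ 2))) (𝓝[>] 0) (𝓝 (512 / 63 * (2 * (0:ℝ) ^ 2 * deriv h ((0:ℝ) ^ 2) ^ 2 - 6 * h ((0:ℝ) ^ 2) * deriv h ((0:ℝ) ^ 2)))) :=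
    ((by fun_prop : Continuous fun r => 512 / 63 * (2 * r ^ 2 * deriv h (r ^ 2) ^ 2 - 6 * h (r ^ 2) * deriv h (r ^ 2))).tendsto 0).mono_left nhdsWithin_le_nhds
  have eF : 512 / 63 * (2 * (0:ℝ) ^ 2 * deriv h ((0:ℝ) ^ 2) ^ 2 - 6 * h ((0:ℝ) ^ 2) * deriv h ((0:ℝ) ^ 2)) = 0 := by norm_num [h0]
  rw [eF] at TF
  have TP := tendsto_P_nhdsGT hh hH hC
  -- the two apex-slope terms
  have Tαq : Tendsto (fun r => 16 * (4 * r ^ 2 * deriv h (r ^ 2) ^ 2 + 12 * h (r ^ 2) * deriv h (r ^ 2)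
      + 9 * ((r ^ 2)⁻¹ * h (r ^ 2)) * h (r ^ 2))) (𝓝[>] 0)
      (𝓝 (16 * (4 * 0 * deriv h 0 ^ 2 + 12 * 0 * deriv h 0 + 9 * deriv h 0 * 0))) :=
    ((((Tr2.const_mul 4).mul (Td1.pow 2)).add ((Thc.const_mul 12).mul Td1)).add ((Th.const_mul 9).mul Thc)).const_mul 16
  have TGq : Tendsto (fun r => 96 / 35 * (4 * r ^ 2 * deriv h (r ^ 2) ^ 2 - 12 * h (r ^ 2) * deriv h (r ^ 2)
      - 15 * ((r ^ 2)⁻¹ * h (r ^ 2)) * h (r ^ 2))) (𝓝[>] 0)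
      (𝓝 (96 / 35 * (4 * 0 * deriv h 0 ^ 2 - 12 * 0 * deriv h 0 - 15 * deriv h 0 * 0))) :=
    ((((Tr2.const_mul 4).mul (Td1.pow 2)).sub ((Thc.const_mul 12).mul Td1)).sub ((Th.const_mul 15).mul Thc)).const_mul (96 / 35)
  have T := ((((Tαq.add (T2.const_mul (12 / 5))).sub TGq).sub (T4.const_mul (80 / 63))).sub TF).add (TP.const_mul (10240 / 21))
  have key : Tendsto (fun r => 16 * (4 * r ^ 2 * deriv h (r ^ 2) ^ 2 + 12 * h (r ^ 2) * deriv h (r ^ 2)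
      + 9 * ((r ^ 2)⁻¹ * h (r ^ 2)) * h (r ^ 2))
      + 12 / 5 * ((r ^ 7)⁻¹ * (∫ ρ in (0:ℝ)..r, ρ ^ 6 * (24 / 7 * (4 * ρ ^ 2 * deriv h (ρ ^ 2) ^ 2 + 42 * h (ρ ^ 2) * deriv h (ρ ^ 2) + 12 * ρ ^ 2 * h (ρ ^ 2) * deriv (deriv h) (ρ ^ 2) - 8 * ρ ^ 4 * deriv h (ρ ^ 2) * deriv (deriv h) (ρ ^ 2)))))
      - 96 / 35 * (4 * r ^ 2 * deriv h (r ^ 2) ^ 2 - 12 * h (r ^ 2) * deriv h (r ^ 2) - 15 * ((r ^ 2)⁻¹ * h (r ^ 2)) * h (r ^ 2))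
      - 80 / 63 * ((r ^ 9)⁻¹ * (∫ ρ in (0:ℝ)..r, ρ ^ 10 * (8 * (52 * deriv h (ρ ^ 2) ^ 2 - 12 * h (ρ ^ 2) * deriv (deriv h) (ρ ^ 2) + 8 * ρ ^ 2 * deriv h (ρ ^ 2) * deriv (deriv h) (ρ ^ 2)))))
      - 512 / 63 * (2 * r ^ 2 * deriv h (r ^ 2) ^ 2 - 6 * h (r ^ 2) * deriv h (r ^ 2))
      + 10240 / 21 * (∫ ρ in Ioi r, ρ * deriv h (ρ ^ 2) ^ 2)) (𝓝[>] 0)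
      (𝓝 (16 * (4 * 0 * deriv h 0 ^ 2 + 12 * 0 * deriv h 0 + 9 * deriv h 0 * 0) + 12 / 5 * 0
        - 96 / 35 * (4 * 0 * deriv h 0 ^ 2 - 12 * 0 * deriv h 0 - 15 * deriv h 0 * 0) - 80 / 63 * 0 - 0
        + 10240 / 21 * (∫ ρ in Ioi 0, ρ * deriv h (ρ ^ 2) ^ 2))) :=
    T.congr fun r => by ring
  have eV : 16 * (4 * 0 * deriv h 0 ^ 2 + 12 * 0 * deriv h 0 + 9 * deriv h 0 * 0) + 12 / 5 * 0
        - 96 / 35 * (4 * 0 * deriv h 0 ^ 2 - 12 * 0 * deriv h 0 - 15 * deriv h 0 * 0) - 80 / 63 * 0 - 0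
        + 10240 / 21 * (∫ ρ in Ioi 0, ρ * deriv h (ρ ^ 2) ^ 2) = 10240 / 21 * (∫ ρ in Ioi 0, ρ * deriv h (ρ ^ 2) ^ 2) := by ring
  rw [eV] at key
  refine key.congr' ?_
  filter_upwards [self_mem_nhdsWithin] with r hr
  have hr0 : (r:ℝ) ≠ 0 := ne_of_gt hr
  rw [hornBracket_eq hh hH hC hr]
  field_simp
  ring

/-- THE CASE `r₀ = 0`: if the bracket vanishes along a sequence `uₙ → 0⁺` then `h(0) = 0` and `∫_(0,∞) ρ h′(ρ²)² = 0`. -/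
theorem onset_zero (hh : ContDiff ℝ ∞ h) (hH : ∀ r, 0 ≤ r → H r = h (r ^ 2))
    (hC : ∀ r, 1 ≤ r → r ^ 5 * |H r| ≤ C ∧ r ^ 6 * |deriv H r| ≤ C ∧ r ^ 7 * |deriv (deriv H) r| ≤ C) {u : ℕ → ℝ} (hu0 : ∀ n, 0 < u n)
    (hu : Tendsto u atTop (𝓝 0)) (hW : ∀ n, hornBracket H (u n) = 0) :
    h 0 = 0 ∧ (∫ ρ in Ioi 0, ρ * deriv h (ρ ^ 2) ^ 2) = 0 := by
  have hu' : Tendsto u atTop (𝓝[>] 0) :=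
    tendsto_nhdsWithin_iff.mpr ⟨hu, Eventually.of_forall hu0⟩
  have hzero : Tendsto (fun n => hornBracket H (u n)) atTop (𝓝 0) := by
    simp only [hW]; exact tendsto_const_nhds
  have h1 := tendsto_nhds_unique ((tendsto_hornBracket_nhdsGT hh hH hC).comp hu') hzero
  have h0 : h 0 = 0 := by nlinarith [sq_nonneg (h 0)]
  refine ⟨h0, ?_⟩
  have hzero2 : Tendsto (fun n => hornBracket H (u n) * (u n ^ 2)⁻¹) atTop (𝓝 0) := by
    simp only [hW, zero_mul]; exact tendsto_const_nhds
  have h2 := tendsto_nhds_unique ((tendsto_hornBracket_div_sq_nhdsGT hh hH hC h0).comp hu') hzero2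
  linarith

end Limits

/-! ## Part F — THEOREM PHR -/

section Main

open scoped ContDiff

variable {h H : ℝ → ℝ} {C : ℝ}

/-- a constant admissible profile is zero (decay). -/
theorem const_eq_zero_of_decay {c : ℝ} (hHc : ∀ r, 0 ≤ r → H r = c)
    (hC : ∀ r, 1 ≤ r → r ^ 5 * |H r| ≤ C ∧ r ^ 6 * |deriv H r| ≤ C ∧ r ^ 7 * |deriv (deriv H) r| ≤ C) : c = 0 := by
  by_contra hc
  have hC0 : 0 ≤ C := decay_const_nonneg hC
  set r : ℝ := max 1 ((C + 1) / |c|) with hr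
  have hr1 : 1 ≤ r := le_max_left _ _
  have hcpos : 0 < |c| := abs_pos.mpr hc
  have h5 := (hC r hr1).1
  rw [hHc r (le_trans zero_le_one hr1)] at h5
  have hr5 : r ≤ r ^ 5 := le_self_pow₀ hr1 (by norm_num)
  have hge : (C + 1) / |c| ≤ r := le_max_right _ _
  have key : C + 1 ≤ r * |c| := by rwa [div_le_iff₀ hcpos] at hge
  nlinarith [mul_le_mul_of_nonneg_right hr5 hcpos.le]

/-- if `h′(ρ²) = 0` for all `ρ > 0` then the profile is the constant `h(0)` on `[0,∞)`. -/
theorem profile_const_of_deriv_eq_zero_all (hh : ContDiff ℝ ∞ h) (hH : ∀ r, 0 ≤ r → H r = h (r ^ 2))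
    (hz : ∀ ρ, 0 < ρ → deriv h (ρ ^ 2) = 0) : ∀ r, 0 ≤ r → H r = h 0 := by
  intro r hr
  rw [hH r hr]
  exact profile_const_of_deriv_eq_zero hh (R := r) (fun ρ hρ => hz ρ hρ.1) r ⟨hr, le_rfl⟩

/-- **THEOREM PHR «PROFILE-HORN RIGIDITY»** (LINE g10-2 «PROFILE HORN», ns-idea-6 g10; paper proof GERMS.md §g10, checked line by line
by idea-crit-4 g6): the horn equation `K · W̃[H] ≡ 0` on `(0,∞)` has no admissible root other than `H ≡ 0`.
Proof: below the vorticity-onset radius `r₀ = inf{K ≠ 0}` the flux identity `(ρ⁶H′)′ = ρ⁶K` and smoothness at the apex make `H ≡ h₀`;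
`W̃` is continuous on `(0,∞)` and vanishes along a sequence decreasing to `r₀`; at `r₀ > 0`, LEMMA J2 (`J₂ = (12/7)G₂`, local quadrupole far field)
and LEMMA J4 (`J₄ = −4H′² + 24HH′/r + 120∫H′²/ρ`) give `W̃(r₀) = (1296/7) h₀² + (10240/21) r₀² ∫_(r₀,∞) ρ h′(ρ²)² = 0`, so `h₀ = 0` and `H′ ≡ 0`
beyond `r₀`; at `r₀ = 0`, `W̃(0⁺) = (1296/7) h₀²` forces `h₀ = 0` and then `W̃(r)/r² → (10240/21) ∫_(0,∞) ρ h′(ρ²)²` forces `H′ ≡ 0`;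
if `K ≡ 0` the profile is constant and the decay clause kills it. -/
theorem profileHornRigidity_holds : ProfileHornRigidity := by
  intro H hAdm hKW
  obtain ⟨⟨h, hh, hH⟩, C, hC⟩ := hAdm
  have hd := differentiable_of_smooth hh
  have hd2 := differentiable_deriv_of_smooth hh
  -- it suffices to show `h′(ρ²) = 0` for all `ρ > 0` (then `H ≡ h(0)`, and decay gives `h(0) = 0`)
  suffices hz : ∀ ρ, 0 < ρ → deriv h (ρ ^ 2) = 0 by
    have hconst := profile_const_of_deriv_eq_zero_all hh hH hz
    have h00 : h 0 = 0 := const_eq_zero_of_decay hconst hC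
    intro r hr
    rw [hconst r hr, h00]
  set S : Set ℝ := {ρ : ℝ | 0 < ρ ∧ (14 * deriv h (ρ ^ 2) + 4 * ρ ^ 2 * deriv (deriv h) (ρ ^ 2)) ≠ 0} with hS_def
  by_cases hS : S.Nonempty
  · -- there is vorticity: the onset radius
    have hbdd : BddBelow S := ⟨0, fun x hx => hx.1.le⟩
    have hr₀ : 0 ≤ sInf S := le_csInf hS fun x hx => hx.1.le
    have hbelow : ∀ ρ ∈ Ioo 0 (sInf S), (14 * deriv h (ρ ^ 2) + 4 * ρ ^ 2 * deriv (deriv h) (ρ ^ 2)) = 0 := by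
      intro ρ hρ
      by_contra hne
      exact not_lt_of_ge (csInf_le hbdd ⟨hρ.1, hne⟩) hρ.2
    obtain ⟨u, -, hu, huS⟩ := exists_seq_tendsto_sInf hS hbdd
    have hWu : ∀ n, hornBracket H (u n) = 0 := by
      intro n
      have h1 := hKW (u n) (huS n).1
      rw [vortAmp_eq hd hd2 hH (huS n).1] at h1
      exact (mul_eq_zero.mp h1).resolve_left (huS n).2
    rcases hr₀.eq_or_lt with h0 | hpos
    · -- onset at the apex
      rw [← h0] at hu
      obtain ⟨-, hP⟩ := onset_zero hh hH hC (fun n => (huS n).1) hu hWu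
      exact deriv_eq_zero_of_integral_eq_zero hh le_rfl (integrableOn_P_model (a := 0) hh hH hC) hP
    · -- onset at a positive radius
      set r₀ := sInf S with hr₀_def
      have hcont : ContinuousAt (hornBracket H) r₀ :=
        (continuousOn_hornBracket hh hH hC).continuousAt (Ioi_mem_nhds hpos)
      have hlim := tendsto_nhds_unique (hcont.tendsto.comp hu)
        (by simp only [Function.comp_def, hWu]; exact tendsto_const_nhds)
      -- `W̃(r₀) = 144 h₀² + (288/7) h₀² + (10240/21) r₀² P(r₀) = 0`
      rw [hornBracket_onset hh hH hC hpos hbelow] at hlim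
      have hPnn : 0 ≤ (∫ ρ in Ioi r₀, ρ * deriv h (ρ ^ 2) ^ 2) :=
        setIntegral_nonneg measurableSet_Ioi fun ρ hρ =>
          mul_nonneg (le_of_lt (lt_trans hpos hρ)) (sq_nonneg _)
      have hP : (∫ ρ in Ioi r₀, ρ * deriv h (ρ ^ 2) ^ 2) = 0 := by
        nlinarith [sq_nonneg (h 0), mul_nonneg (sq_nonneg r₀) hPnn, pow_pos hpos 2]
      have hout := deriv_eq_zero_of_integral_eq_zero hh hpos.le (integrableOn_P_model (a := r₀) hh hH hC) hP
      have hin := deriv_eq_zero_below hh hbelow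
      intro ρ hρ
      rcases le_or_gt ρ r₀ with hle | hlt
      · exact hin ρ ⟨hρ, hle⟩
      · exact hout ρ hlt
  · -- no vorticity at all: `K ≡ 0`, the profile is flat
    have hK : ∀ ρ, 0 < ρ → (14 * deriv h (ρ ^ 2) + 4 * ρ ^ 2 * deriv (deriv h) (ρ ^ 2)) = 0 := by
      intro ρ hρ
      by_contra hne
      exact hS ⟨ρ, hρ, hne⟩
    intro ρ hρ
    exact deriv_eq_zero_below hh (r₀ := ρ + 1) (fun x hx => hK x hx.1) ρ ⟨hρ, by linarith⟩

end Main

end Summit.NavierStokesRegularity.NavierStokesRegularity.Theorems.UnthreadedRigidity.ProfileHorn
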